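import Literature.Barriers.CriticalPhenomena.WeaklySAWPerturbativeBetaBounds
import HarnessLib

/-!
# BBS 2015 / BBS-rg-pt: the decay of `β_j(m²)` beyond the mass scale for the weakly self-avoiding
# walk (`d = 4`) — `|β_j(m²)| ≤ K_L(1+L^{2j}m²/(8+m²))^{-p}` and `|β_j(m²)| ≤ C_{L,Ω}Ω^{-(j-j_m)₊}`

Companion of `WeaklySAWPerturbativeBetaBounds.lean` (the bound `|β_j(m²)| ≤ KL⁴`, i.e. the first
clause of Assumption (A1), by support-sensitive counting from the scaling estimate
`|C_{j+1;0,x}| ≤ c/L^{2j}`). Sources: Bauerschmidt–Brydges–Slade, CMP 337 (2015) [BBS2015], §6.1: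
"for `m² > 0`, by (scaling-estimate), `β_j` decays extremely rapidly to `0` for `j ≥ j_m` where
`j_m` is the mass scale, i.e., the smallest `j` such that `L^{2j}m² ≥ 1`", with the scaling
estimate of §5.2 "`|∇^α∇^βC_{j;x,y}| ≤ c(1+m²L^{2(j-1)})^{-k}L^{-(j-1)(2[φ]+|α|₁+|β|₁)}`"; and
R. Bauerschmidt, D. C. Brydges, G. Slade, *A renormalisation group method. III. Perturbative
analysis*, J. Stat. Phys. **159** (2015), arXiv:1403.7252 [BBS-rg-pt], proof of Proposition 4.2.2:
"Let `k` be such that `L^{2k} ≥ Ω`. Then, for all `j ≥ 0`, `(1+m²L^{2j})^{-k} ≤ L^{-2k(j-j_m)₊} ≤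
Ω^{-(j-j_m)₊}`. … We apply Lemma 6.1.2 and (mchibd) to see that there is a constant `C` such that
`|β_j| ≤ CΩ^{-(j-j_m)₊}`".

## What this file proves (everything; no definition, no named fact)

For the explicit `β_j(m²) = CTWSAW.betaPT 4 L m² j` (BBS2015 §6.1), `m² = s`:

* `abs_Gam_four_le_decay` — the `d = 4` scaling estimate WITH its mass decay, read off the tree's
  `FRD.abs_Gam_le_three_le`: `|Γ_{i+1}(x;s)| ≤ c(1+L^{2i}s/(8+s))^{-p}/L^{2i}` (`s > 0`, every `p`);
* **`abs_betaPT_le_decay`** — `|β_j(s)| ≤ KL⁴(1+L^{2j}s/(8+s))^{-p}` for `s > 0`, all `j` (the decay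
  factor of `C_{j+1}` survives the support-sensitive counting of `WeaklySAWPerturbativeBetaBounds`);
* `geom_sum_le_pow`, `geom_sum_four_le_pow` — `Σ_{i<j}Lⁱ ≤ Lʲ`, `Σ_{i<j}L^{4i} ≤ L^{4j}` (`L ≥ 2`);
* `exists_pow_sq_ge` — "let `k` be such that `L^{2k} ≥ Ω`";
* **`abs_betaPT_le_cutoff`** — for `Ω > 1`, `L ≥ 2` there is `C = C(L,Ω)` such that for all
  `s ∈ (0,1]` and every `j_m` with `sL^{2(j_m+1)} > 1` (the mass scale `⌊log_{L²}s⁻¹⌋` is the least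
  such), `|β_j(s)| ≤ CΩ^{-(j-j_m)₊}` for all `j` — the display `|β_j| ≤ CΩ^{-(j-j_m)₊}` of the proof
  of Proposition 4.2.2 of [BBS-rg-pt].
-/

noncomputable section

open Set Filter Topology
open Literature.Probability.LatticeModels
open scoped BigOperators

namespace Literature.Barriers.CriticalPhenomena

namespace CTWSAW

open LongRangePhi4 LongRangePhi4.FRD

/-! ### The scaling estimate with mass decay at `d = 4` -/

/-- **`|Γ_{i+1}(x;s)| ≤ c(1+L^{2i}s/(8+s))^{-p}/L^{2i}`** for `s > 0`, `L ≥ 2`, all `i`, `x`, and every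
`p` (`d = 4`: `(L^i)²/(L^i)⁴ = L^{-2i}`, `1/(8+s) ≤ 1`).
[cite: BauerschmidtBrydgesSlade2015LogCorr, §5.2 (display (scaling-estimate), α = β = 0, d = 4)] -/
theorem abs_Gam_four_le_decay (p : ℕ) : ∃ c : ℝ, 0 < c ∧ ∀ L : ℝ, 2 ≤ L → ∀ s : ℝ, 0 < s →
    ∀ i : ℕ, ∀ x : Site 4,
      |Gam 4 L s (i + 1) x| ≤ c * ((1 + L ^ (2 * i) * s / (8 + s)) ^ p)⁻¹ / L ^ (2 * i) := by
  obtain ⟨c, hc, h⟩ := abs_Gam_le_three_le (d := 4) (by norm_num) p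
  refine ⟨c, hc, fun L hL s hs i x => ?_⟩
  have hL0 : L ≠ 0 := by linarith
  have hL0' : (0 : ℝ) < L := by linarith
  have := h L hL s hs (i + 1) (by omega) x
  rw [Nat.add_sub_cancel, scale_ratio_eq hL0 (by norm_num) i] at this
  refine this.trans ?_
  have e1 : ((1 : ℝ) / L ^ (4 - 2)) ^ i = 1 / L ^ (2 * i) := by
    rw [show (4 - 2 : ℕ) = 2 by norm_num, one_div, inv_pow, ← pow_mul, one_div]
  have e2 : (L ^ i) ^ 2 = L ^ (2 * i) := by rw [← pow_mul, mul_comm]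
  rw [e1, e2, show (2 * ((4 : ℕ) : ℝ) + s) = 8 + s by norm_num]
  have hϑ : 0 < ((1 + L ^ (2 * i) * s / (8 + s)) ^ p)⁻¹ := by positivity
  have hfrac : 1 / (8 + s) ≤ 1 := by
    rw [div_le_one (by positivity)]; linarith
  calc c * (1 / (8 + s) * ((1 + L ^ (2 * i) * s / (8 + s)) ^ p)⁻¹) * (1 / L ^ (2 * i))
      ≤ c * (1 * ((1 + L ^ (2 * i) * s / (8 + s)) ^ p)⁻¹) * (1 / L ^ (2 * i)) := by
        gcongr
    _ = c * ((1 + L ^ (2 * i) * s / (8 + s)) ^ p)⁻¹ / L ^ (2 * i) := by ring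

/-! ### Two geometric sums -/

/-- `Σ_{i<j}Lⁱ ≤ Lʲ` for `L ≥ 2`. [folklore] -/
theorem geom_sum_le_pow {L : ℝ} (hL : 2 ≤ L) (j : ℕ) : ∑ i ∈ Finset.range j, L ^ i ≤ L ^ j := by
  induction j with
  | zero => simp
  | succ j ih =>
    rw [Finset.sum_range_succ, pow_succ]
    have h2 : 0 ≤ L ^ j := by positivity
    nlinarith

/-- `Σ_{i<j}L^{4i} ≤ L^{4j}` for `L ≥ 2`. [folklore] -/
theorem geom_sum_four_le_pow {L : ℝ} (hL : 2 ≤ L) (j : ℕ) :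
    ∑ i ∈ Finset.range j, L ^ (4 * i) ≤ L ^ (4 * j) := by
  have hL4 : (2 : ℝ) ≤ L ^ 4 := by
    have : (2 : ℝ) ^ 4 ≤ L ^ 4 := pow_le_pow_left₀ (by norm_num) hL 4
    linarith [show (2 : ℝ) ≤ 2 ^ 4 by norm_num]
  have := geom_sum_le_pow hL4 j
  simp_rw [← pow_mul] at this
  exact this

/-! ### The decay of `β_j` beyond the mass scale -/

/-- **`|β_j(s)| ≤ KL⁴(1+L^{2j}s/(8+s))^{-p}`** for `s > 0`, `L ≥ 2`, all `j` and every `p` (`d = 4`):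
`β_j = 8Σ_x C_{j+1}(2w_j + C_{j+1})` with `|C_{j+1}| ≤ cϑ_j/L^{2j}`, `ϑ_j = (1+L^{2j}s/(8+s))^{-p} ≤ 1`,
`|w_j| ≤ Σ_{i<j}(c₀/L^{2i})𝟙{|x|₁<½L^{i+1}}`, `Σ_x𝟙_i ≤ 16L⁴L^{4i}`, `Σ_{i<j}L^{2i} ≤ 2L^{2j}`.
[cite: BauerschmidtBrydgesSlade2015LogCorr, §6.1 ("for m² > 0, by (scaling-estimate), β_j decays extremely rapidly to 0 for j ≥ j_m")] -/
theorem abs_betaPT_le_decay (p : ℕ) : ∃ K : ℝ, 0 < K ∧ ∀ L : ℝ, 2 ≤ L → ∀ s : ℝ, 0 < s → ∀ j : ℕ,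
    |betaPT 4 L s j| ≤ K * L ^ 4 * ((1 + L ^ (2 * j) * s / (8 + s)) ^ p)⁻¹ := by
  obtain ⟨c₀, hc₀, h₀⟩ := abs_Gam_four_le
  obtain ⟨c₁, hc₁, h₁⟩ := abs_Gam_four_le_decay p
  refine ⟨8 * (64 * c₀ * c₁ + 16 * c₁ ^ 2), by positivity, fun L hL s hs j => ?_⟩
  classical
  have hL1 : (1 : ℝ) ≤ L := by linarith
  have hL0 : (0 : ℝ) < L := by linarith
  set ϑ : ℝ := ((1 + L ^ (2 * j) * s / (8 + s)) ^ p)⁻¹ with hϑdef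
  have hϑ0 : 0 < ϑ := by positivity
  have hϑ1 : ϑ ≤ 1 := by
    rw [hϑdef]
    refine inv_le_one_of_one_le₀ (one_le_pow₀ ?_)
    have : 0 ≤ L ^ (2 * j) * s / (8 + s) := by positivity
    linarith
  -- abbreviations as in `BBS2015_A1_bounded`
  set a : ℕ → ℝ := fun i => c₀ / L ^ (2 * i) with ha
  set ind : ℕ → Site 4 → ℝ := fun i x => if x ∈ PT.ball (L ^ (i + 1) / 2) then (1 : ℝ) else 0
    with hind
  set S : Finset (Site 4) := PT.ball (L ^ (j + 1) / 2) with hSdef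
  set a' : ℝ := c₁ * ϑ / L ^ (2 * j) with ha'
  have ha0 : ∀ i, 0 ≤ a i := fun i => by simp only [ha]; positivity
  have ha'0 : 0 ≤ a' := by positivity
  have hind0 : ∀ i x, 0 ≤ ind i x := fun i x => by
    simp only [hind]; split_ifs <;> norm_num
  -- pointwise
  have hGj : ∀ x, |Gam 4 L s (j + 1) x| ≤ a' := fun x => by
    have := h₁ L hL s hs j x
    rw [ha']
    exact this
  have hW : ∀ x, |covSum 4 L s j x| ≤ ∑ i ∈ Finset.range j, a i * ind i x := fun x =>
    abs_covSum_four_le h₀ hL hs.le j x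
  have hpt : ∀ x, |covSum 4 L s (j + 1) x ^ 2 - covSum 4 L s j x ^ 2| ≤
      a' * (2 * ∑ i ∈ Finset.range j, a i * ind i x + a') := by
    intro x
    rw [covSum_succ]
    have e : (covSum 4 L s j x + Gam 4 L s (j + 1) x) ^ 2 - covSum 4 L s j x ^ 2 =
        Gam 4 L s (j + 1) x * (2 * covSum 4 L s j x + Gam 4 L s (j + 1) x) := by ring
    rw [e, abs_mul]
    refine mul_le_mul (hGj x) ?_ (abs_nonneg _) ha'0
    calc |2 * covSum 4 L s j x + Gam 4 L s (j + 1) x|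
        ≤ |2 * covSum 4 L s j x| + |Gam 4 L s (j + 1) x| := abs_add_le _ _
      _ ≤ 2 * ∑ i ∈ Finset.range j, a i * ind i x + a' := by
          rw [abs_mul, abs_two]; exact add_le_add (by linarith [hW x]) (hGj x)
  -- sums over `S`
  have hI : ∀ i, ∑ x ∈ S, ind i x ≤ 16 * L ^ 4 * L ^ (4 * i) := fun i => sum_ball_indicator_le _ hL1 i
  have hcard : (S.card : ℝ) ≤ 16 * L ^ 4 * L ^ (4 * j) := card_ball_four_le hL1 j
  have hSa : ∑ x ∈ S, ∑ i ∈ Finset.range j, a i * ind i x ≤ 32 * c₀ * L ^ 4 * L ^ (2 * j) := by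
    rw [Finset.sum_comm]
    have hai : ∀ i, a i * (16 * L ^ 4 * L ^ (4 * i)) = 16 * c₀ * L ^ 4 * L ^ (2 * i) := by
      intro i
      simp only [ha]
      have : L ^ (4 * i) = L ^ (2 * i) * L ^ (2 * i) := by rw [← pow_add]; ring_nf
      rw [this]
      field_simp
    have h1 : ∀ i ∈ Finset.range j, ∑ x ∈ S, a i * ind i x ≤ 16 * c₀ * L ^ 4 * L ^ (2 * i) := by
      intro i _
      rw [← Finset.mul_sum, ← hai i]
      exact mul_le_mul_of_nonneg_left (hI i) (ha0 i)
    refine (Finset.sum_le_sum h1).trans ?_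
    rw [← Finset.mul_sum]
    have := geom_sum_sq_le hL j
    have k0 : 0 ≤ 16 * c₀ * L ^ 4 := by positivity
    nlinarith [mul_le_mul_of_nonneg_left this k0]
  have ha'L : a' * L ^ (2 * j) = c₁ * ϑ := by
    simp only [ha']; field_simp
  have htot : ∑ x ∈ S, |covSum 4 L s (j + 1) x ^ 2 - covSum 4 L s j x ^ 2| ≤
      (64 * c₀ * c₁ + 16 * c₁ ^ 2) * L ^ 4 * ϑ := by
    refine (Finset.sum_le_sum fun x _ => hpt x).trans ?_
    rw [← Finset.mul_sum, Finset.sum_add_distrib, Finset.sum_const, nsmul_eq_mul, ← Finset.mul_sum]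
    have h1 : 2 * ∑ x ∈ S, ∑ i ∈ Finset.range j, a i * ind i x + (S.card : ℝ) * a' ≤
        2 * (32 * c₀ * L ^ 4 * L ^ (2 * j)) + 16 * L ^ 4 * L ^ (4 * j) * a' := by
      have := mul_le_mul_of_nonneg_right hcard ha'0
      linarith
    calc a' * (2 * ∑ x ∈ S, ∑ i ∈ Finset.range j, a i * ind i x + (S.card : ℝ) * a')
        ≤ a' * (2 * (32 * c₀ * L ^ 4 * L ^ (2 * j)) + 16 * L ^ 4 * L ^ (4 * j) * a') :=
          mul_le_mul_of_nonneg_left h1 ha'0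
      _ = 64 * c₀ * L ^ 4 * (a' * L ^ (2 * j)) + 16 * L ^ 4 * (a' * L ^ (2 * j)) ^ 2 := by
          have : L ^ (4 * j) = L ^ (2 * j) * L ^ (2 * j) := by rw [← pow_add]; ring_nf
          rw [this]; ring
      _ = 64 * c₀ * L ^ 4 * (c₁ * ϑ) + 16 * L ^ 4 * (c₁ * ϑ) ^ 2 := by rw [ha'L]
      _ ≤ 64 * c₀ * L ^ 4 * (c₁ * ϑ) + 16 * L ^ 4 * (c₁ ^ 2 * ϑ) := by
          have hsq : (c₁ * ϑ) ^ 2 ≤ c₁ ^ 2 * ϑ := by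
            rw [mul_pow]
            refine mul_le_mul_of_nonneg_left ?_ (by positivity)
            nlinarith
          have hL4 : 0 ≤ 16 * L ^ 4 := by positivity
          nlinarith [mul_le_mul_of_nonneg_left hsq hL4]
      _ = (64 * c₀ * c₁ + 16 * c₁ ^ 2) * L ^ 4 * ϑ := by ring
  rw [betaPT_eq_sum (by norm_num) hL1 hs.le j, abs_mul, show |(8 : ℝ)| = 8 by norm_num]
  calc 8 * |∑ x ∈ S, (covSum 4 L s (j + 1) x ^ 2 - covSum 4 L s j x ^ 2)|
      ≤ 8 * ((64 * c₀ * c₁ + 16 * c₁ ^ 2) * L ^ 4 * ϑ) :=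
        mul_le_mul_of_nonneg_left ((Finset.abs_sum_le_sum_abs _ _).trans htot) (by norm_num)
    _ = 8 * (64 * c₀ * c₁ + 16 * c₁ ^ 2) * L ^ 4 * ϑ := by ring

/-! ### The `Ω`-form: `|β_j| ≤ CΩ^{-(j-j_m)₊}` -/

/-- "Let `k` be such that `L^{2k} ≥ Ω`" (`L > 1`). [cite: BauerschmidtBrydgesSlade2015LogCorr, §6.1 (Ω-scale; [BBS-rg-pt] proof of Proposition 4.2.2)] -/
theorem exists_pow_sq_ge {L : ℝ} (hL : 1 < L) (Ω : ℝ) : ∃ k : ℕ, Ω ≤ (L ^ 2) ^ k := by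
  have hL2 : 1 < L ^ 2 := by nlinarith
  obtain ⟨k, hk⟩ := pow_unbounded_of_one_lt Ω hL2
  exact ⟨k, hk.le⟩

/-- **`|β_j(s)| ≤ CΩ^{-(j-j_m)₊}`** (`d = 4`, `L ≥ 2`, `Ω > 1`, `C = C(L,Ω)`): for all `s ∈ (0,1]` and
every `j_m` with `sL^{2(j_m+1)} > 1` (so for the mass scale `j_m = ⌊log_{L²}s⁻¹⌋`), for all `j` —
with `k` such that `L^{2k} ≥ Ω`: `(1+L^{2j}s/(8+s))^{-k} ≤ (9/(L^{2j}s))^k ≤ 9^kL^{-2k(j-j_m-1)} ≤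
9^kΩ·Ω^{-(j-j_m)}` for `j > j_m`, and `≤ 1` otherwise. (`j - j_m` is truncated subtraction.)
[cite: BauerschmidtBrydgesSlade2015LogCorr, §6.1 (β_j "decays extremely rapidly to 0 for j ≥ j_m"; [BBS-rg-pt], proof of Proposition 4.2.2: "|β_j| ≤ CΩ^{-(j-j_m)₊}")] -/
theorem abs_betaPT_le_cutoff {Ω : ℝ} (hΩ : 1 < Ω) {L : ℝ} (hL : 2 ≤ L) :
    ∃ C : ℝ, 0 < C ∧ ∀ s : ℝ, 0 < s → s ≤ 1 → ∀ jm : ℕ, 1 < s * L ^ (2 * (jm + 1)) →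
      ∀ j : ℕ, |betaPT 4 L s j| ≤ C * (Ω ^ (j - jm))⁻¹ := by
  have hL1 : (1 : ℝ) < L := by linarith
  have hL0 : (0 : ℝ) < L := by linarith
  have hΩ0 : 0 < Ω := by linarith
  obtain ⟨k, hk⟩ := exists_pow_sq_ge hL1 Ω
  obtain ⟨K, hK, hβ⟩ := abs_betaPT_le_decay k
  refine ⟨K * L ^ 4 * (9 ^ k * Ω), by positivity, fun s hs hs1 jm hjm j => ?_⟩
  have hb := hβ L hL s hs j
  set ϑ : ℝ := ((1 + L ^ (2 * j) * s / (8 + s)) ^ k)⁻¹ with hϑdef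
  have hϑ1 : ϑ ≤ 1 := by
    rw [hϑdef]
    refine inv_le_one_of_one_le₀ (one_le_pow₀ ?_)
    have : 0 ≤ L ^ (2 * j) * s / (8 + s) := by positivity
    linarith
  have h9 : (1 : ℝ) ≤ 9 ^ k * Ω := by
    have : (1 : ℝ) ≤ 9 ^ k := one_le_pow₀ (by norm_num)
    nlinarith
  -- the key comparison `ϑ ≤ 9^kΩ · Ω^{-(j-jm)}`
  have hkey : ϑ ≤ 9 ^ k * Ω * (Ω ^ (j - jm))⁻¹ := by
    rcases le_or_gt j jm with hj | hj
    · rw [Nat.sub_eq_zero_of_le hj, pow_zero, inv_one, mul_one]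
      exact hϑ1.trans h9
    · -- `j ≥ jm + 1`: write `j = (jm + 1) + r`, `j - jm = r + 1`
      obtain ⟨r, hr⟩ := Nat.exists_eq_add_of_lt hj
      have hjr : j - jm = r + 1 := by omega
      rw [hjr]
      -- `L^{2j}s ≥ L^{2r}`
      have hX : L ^ (2 * r) ≤ L ^ (2 * j) * s := by
        have e : L ^ (2 * j) * s = L ^ (2 * r) * (s * L ^ (2 * (jm + 1))) := by
          rw [hr, show 2 * (jm + r + 1) = 2 * r + 2 * (jm + 1) by ring, pow_add]; ring
        rw [e]
        have : 0 ≤ L ^ (2 * r) := by positivity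
        nlinarith
      -- `1 + L^{2j}s/(8+s) ≥ L^{2r}/9`
      have hbase : L ^ (2 * r) / 9 ≤ 1 + L ^ (2 * j) * s / (8 + s) := by
        have h8 : L ^ (2 * j) * s / 9 ≤ L ^ (2 * j) * s / (8 + s) := by
          refine div_le_div_of_nonneg_left (by positivity) (by positivity) (by linarith)
        have : L ^ (2 * r) / 9 ≤ L ^ (2 * j) * s / 9 := div_le_div_of_nonneg_right hX (by norm_num)
        linarith
      have hb9 : 0 < L ^ (2 * r) / 9 := by positivity
      -- `ϑ ≤ (9/L^{2r})^k = 9^k (L^{2k})^{-r} ≤ 9^k Ω^{-r}`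
      have h1 : ϑ ≤ ((L ^ (2 * r) / 9) ^ k)⁻¹ := by
        rw [hϑdef]
        exact inv_anti₀ (pow_pos hb9 k) (pow_le_pow_left₀ hb9.le hbase k)
      have h2 : ((L ^ (2 * r) / 9) ^ k)⁻¹ = 9 ^ k * (((L ^ 2) ^ k) ^ r)⁻¹ := by
        rw [div_pow, inv_div, ← pow_mul, ← pow_mul, ← pow_mul,
          show 2 * r * k = 2 * (k * r) by ring, div_eq_mul_inv]
      have h3 : (((L ^ 2) ^ k) ^ r)⁻¹ ≤ (Ω ^ r)⁻¹ :=
        inv_anti₀ (pow_pos hΩ0 r) (pow_le_pow_left₀ hΩ0.le hk r)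
      calc ϑ ≤ 9 ^ k * (((L ^ 2) ^ k) ^ r)⁻¹ := h1.trans (le_of_eq h2)
        _ ≤ 9 ^ k * (Ω ^ r)⁻¹ := mul_le_mul_of_nonneg_left h3 (by positivity)
        _ = 9 ^ k * Ω * (Ω ^ (r + 1))⁻¹ := by
            rw [pow_succ, mul_inv]
            field_simp
  calc |betaPT 4 L s j| ≤ K * L ^ 4 * ϑ := hb
    _ ≤ K * L ^ 4 * (9 ^ k * Ω * (Ω ^ (j - jm))⁻¹) := mul_le_mul_of_nonneg_left hkey (by positivity)
    _ = K * L ^ 4 * (9 ^ k * Ω) * (Ω ^ (j - jm))⁻¹ := by ring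

end CTWSAW

end Literature.Barriers.CriticalPhenomena
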